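import Summits.HubbardSuperconductivity.HubbardSuperconductivity.Theses.BcsKacWindow
import Literature.MathematicalPhysics.QuantumLattice.PairFieldYangCeiling
import Literature.MathematicalPhysics.QuantumLattice.RayleighBottom

/-!
# Route `BcsKacWindow`, crux `CoherenceWindowLRO` — the Yang side of the coherence window

Helper file for the crux item `stmt-HubbardSuperconductivity-1319` (`CoherenceWindowLRO`, rank 2 of
route `BcsKacWindow`), line `birth` (skeleton `Cruxes/CoherenceWindowLRO/Lines/birth.lean`, stubs
`stub_windowCondensate`, `stub_dWaveCoherence`). The line cuts the crux along Yang's observable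
`λ_max(ρ₂(ψ)) = (twoParticleRDM ψ).supRayleigh`; this file records, sorry-free, the two
kinematic facts that tie the crux's order functional `Re⟨ψ, Δ_d† Δ_d ψ⟩` to that observable:

* `re_star_dotProduct_mulVec_le_supRayleigh_mul` — homogeneous Rayleigh bound
  `Re (v† ρ v) ≤ supRayleigh ρ · ‖v‖²` for EVERY vector `v` (no normalisation);
* `re_expect_pairField_le_normSq_mul_supRayleigh` — **Yang's ceiling in the crux's vocabulary**:
  for an even form factor `g` and `L ≥ 3`, for every Fock vector `ψ` (any particle number, any
  Hamiltonian), `Re⟨ψ, Δ_g† Δ_g ψ⟩ ≤ (L² Σ_e g(e)²) · λ_max(ρ₂(ψ))`; d-wave case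
  `re_expect_pairField_dWave_le_supRayleigh`: `Re⟨ψ, Δ_d† Δ_d ψ⟩ ≤ 4L² · λ_max(ρ₂(ψ))`;
* `window_side_eventually_large` — in the coherence window the torus side diverges as `U → 0⁺`:
  from the upper pin `Δ(U) ≤ e^{-κ₁/U²}` and `s₀ ≤ Δ(U)·L`, for every `L₀` there is `U₂ > 0` with
  `L₀ < L` whenever `0 < U < U₂`;
* `windowCondensate_of_coherenceWindowLRO` — **NECESSITY of a window condensate**: the crux
  `CoherenceWindowLRO` forces, in its own window and for every sector ground state it speaks
  about, a `ρ₂`-eigenvalue at scale `(c₀/4) · Δ(U)² · L² ≤ λ_max(ρ₂(ψ))` — i.e. exactly the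
  statement of `stub_windowCondensate` with `Δ(U)` replaced by `Δ(U)²` (one power of the gap
  scale weaker than the stub, which posits the condensate-NUMBER scale `c · Δ(U) · L²`).

So any proof of the crux proves a window condensate in Yang's sense, and any refutation of a
window condensate at scale `Δ²L²` refutes the crux: the Yang-side cut of line `birth` is forced up
to one power of `Δ(U)`.

Sources: C. N. Yang, Rev. Mod. Phys. **34** (1962) 694, §4 (largest eigenvalue of `ρ₂`,
`v† ρ₂ v ≤ λ_max ‖v‖²`, geminal identity eq. (22)); D. J. Scalapino, Phys. Rep. **250** (1995)
329, §2 eq. (2.2)–(2.4) (the `d_{x²-y²}` pair field, `‖φ_d‖² = 4L²`). Finite-dimensional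
bookkeeping otherwise; no definition and no named fact is introduced.
-/

-- the mandated namespace `Summit.<Summit>.<Problem>.Theorems` repeats `HubbardSuperconductivity`
-- (single-problem summit, D-0017), which the `dupNamespace` linter flags on every declaration
set_option linter.dupNamespace false

namespace Summit.HubbardSuperconductivity.HubbardSuperconductivity.Theorems.BcsKacWindow

open Matrix Literature.MathematicalPhysics.QuantumLattice Literature.Probability.LatticeModels
open Summit.HubbardSuperconductivity.HubbardSuperconductivity.Theses.BcsKacWindow

/-! ### Homogeneous Rayleigh bound -/

/-- **Homogeneous Rayleigh bound**: `Re (v† ρ v) ≤ supRayleigh ρ · Re (v† v)` for every vector `v`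
of a finite index type (for `v = 0` both sides vanish; otherwise rescale `v` to a `dotProduct`-unit
vector and use `Matrix.rayleigh_le_supRayleigh_holds`). Yang, Rev. Mod. Phys. 34 (1962) 694, §4
(`v† ρ₂ v ≤ λ_max ‖v‖²`). [folklore] -/
theorem re_star_dotProduct_mulVec_le_supRayleigh_mul {m : Type*} [Fintype m]
    (ρ : Matrix m m ℂ) (v : m → ℂ) :
    (star v ⬝ᵥ (ρ *ᵥ v)).re ≤ ρ.supRayleigh * (star v ⬝ᵥ v).re := by
  by_cases hv : v = 0
  · subst hv
    simp
  have hpos := RayleighBottom.re_star_dotProduct_self_pos hv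
  obtain ⟨c, hc1, hc2⟩ := RayleighBottom.exists_smul_unit hpos
  -- the unit vector `c • v`
  have h := Matrix.rayleigh_le_supRayleigh_holds ρ (c • v) hc1
  rw [RayleighBottom.star_smul_dotProduct_mulVec_smul, RayleighBottom.re_star_mul_self_mul] at h
  -- multiply by `‖v‖²` and use `‖c‖² ‖v‖² = 1`
  calc (star v ⬝ᵥ (ρ *ᵥ v)).re
      = ‖c‖ ^ 2 * (star v ⬝ᵥ v).re * (star v ⬝ᵥ (ρ *ᵥ v)).re := by rw [hc2, one_mul]
    _ = ‖c‖ ^ 2 * (star v ⬝ᵥ (ρ *ᵥ v)).re * (star v ⬝ᵥ v).re := by ring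
    _ ≤ ρ.supRayleigh * (star v ⬝ᵥ v).re := mul_le_mul_of_nonneg_right h hpos.le

/-! ### Yang's ceiling in the crux's vocabulary -/

section Ceiling

variable (g : Site 2 → ℝ) (L : ℕ) [NeZero L]

/-- **Yang's ceiling for the pair field of an even form factor, in `λ_max` form.** For
`g (-e) = g e`, `L ≥ 3` and EVERY Fock vector `ψ` on the torus of side `L`,
`Re⟨ψ, Δ_g† Δ_g ψ⟩ ≤ (L² Σ_{e ∈ {0} ∪ unitSteps} g(e)²) · λ_max(ρ₂(ψ))`:
`⟨Δ_g† Δ_g⟩ = φ_g† ρ₂ φ_g` (Yang's geminal identity, `Δ_g = P_{φ_g}` for even `g`), the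
homogeneous Rayleigh bound, and `‖φ_g‖² = L² Σ_e g(e)²`. Yang, Rev. Mod. Phys. 34 (1962) 694, §4;
Scalapino, Phys. Rep. 250 (1995) 329, §2. [folklore] -/
theorem re_expect_pairField_le_normSq_mul_supRayleigh (hg : ∀ e, g (-e) = g e) (hL : 3 ≤ L)
    (ψ : Fock (Orb (FermionTorus 2 L))) :
    (expect ((pairField g L)ᴴ * pairField g L) ψ).re ≤
      ((L : ℝ) ^ 2 * ∑ e ∈ insert (0 : Site 2) unitSteps, g e ^ 2) *
        (twoParticleRDM ψ).supRayleigh := by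
  rw [expect_pairField_eq_dotProduct_twoParticleRDM g L expect_pairAnnihilator_conjTranspose_mul_holds
      (pairField_eq_pairAnnihilator_of_even g L hg),
    ← re_star_pairFieldWavefunction_dotProduct_self g L hL, mul_comm]
  exact re_star_dotProduct_mulVec_le_supRayleigh_mul _ _

/-- **Yang's ceiling for the `d_{x²-y²}` pair field, in `λ_max` form**: for `L ≥ 3` and every
Fock vector `ψ`, `Re⟨ψ, Δ_d† Δ_d ψ⟩ ≤ 4L² · λ_max(ρ₂(ψ))` (`‖φ_d‖² = 4L²`). In the crux's
normalisation: `L⁻⁴ Re⟨Δ_d† Δ_d⟩ ≤ 4 λ_max(ρ₂)/L²`, so a pair-field LRO density `≥ c₀ Δ²`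
needs `λ_max(ρ₂) ≥ (c₀/4) Δ² L²`. Yang, Rev. Mod. Phys. 34 (1962) 694, §4; Scalapino,
Phys. Rep. 250 (1995) 329, §2 eq. (2.4). [folklore] -/
theorem re_expect_pairField_dWave_le_supRayleigh (hL : 3 ≤ L) (ψ : Fock (Orb (FermionTorus 2 L))) :
    (expect ((pairField dWaveFormFactor L)ᴴ * pairField dWaveFormFactor L) ψ).re ≤
      4 * (L : ℝ) ^ 2 * (twoParticleRDM ψ).supRayleigh := by
  have h := re_expect_pairField_le_normSq_mul_supRayleigh dWaveFormFactor L dWaveFormFactor_neg hL ψ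
  rw [PairFieldYang.sum_sq_dWaveFormFactor] at h
  linarith [h]

end Ceiling

/-! ### The window side diverges as `U → 0⁺` -/

/-- **In the coherence window the side is eventually large.** If `Δ(U) ≤ e^{-κ₁/U²}` for `U > 0`
(`κ₁ > 0`) and `s₀ > 0`, then for every real `L₀` there is `U₂ > 0` such that `0 < U < U₂` and
`s₀ ≤ Δ(U) · L` force `L₀ < L`: indeed `Δ(U) · L₀ ≤ e^{-κ₁/U²} L₀ < s₀` once
`κ₁/U² > log (L₀/s₀)`. (Elementary; the window `s₀ ≤ Δ(U) L ≤ s` of Scalapino-type finite-size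
statements moves to `L → ∞` as the gap scale closes.) [folklore] -/
theorem window_side_eventually_large {κ₁ s₀ : ℝ} {Δ : ℝ → ℝ} (hκ₁ : 0 < κ₁) (hs₀ : 0 < s₀)
    (hpin : ∀ U : ℝ, 0 < U → Δ U ≤ Real.exp (-(κ₁ / U ^ 2))) (L₀ : ℝ) :
    ∃ U₂ : ℝ, 0 < U₂ ∧ ∀ U : ℝ, 0 < U → U < U₂ → ∀ L : ℕ, s₀ ≤ Δ U * L → L₀ < L := by
  -- work with the positive threshold `L₁ := max L₀ 1`
  set L₁ : ℝ := max L₀ 1 with hL₁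
  have hL₁pos : 0 < L₁ := lt_of_lt_of_le one_pos (le_max_right _ _)
  -- make `e^{-κ₁/U²} < t := s₀ / L₁`
  set t : ℝ := s₀ / L₁ with ht
  have htpos : 0 < t := div_pos hs₀ hL₁pos
  set M : ℝ := max 1 (-Real.log t) with hM
  have hMpos : 0 < M := lt_of_lt_of_le one_pos (le_max_left _ _)
  refine ⟨Real.sqrt (κ₁ / M), Real.sqrt_pos.2 (div_pos hκ₁ hMpos), fun U hU hUlt L hL => ?_⟩
  -- `U² < κ₁ / M`
  have hU2 : U ^ 2 < κ₁ / M := by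
    have h1 : U ^ 2 < Real.sqrt (κ₁ / M) ^ 2 := pow_lt_pow_left₀ hUlt hU.le two_ne_zero
    rwa [Real.sq_sqrt (div_pos hκ₁ hMpos).le] at h1
  have hU2pos : 0 < U ^ 2 := by positivity
  -- hence `κ₁ / U² > M ≥ -log t`, so `e^{-κ₁/U²} < t`
  have hdiv : M < κ₁ / U ^ 2 := by
    rw [lt_div_iff₀ hU2pos]
    calc M * U ^ 2 < M * (κ₁ / M) := mul_lt_mul_of_pos_left hU2 hMpos
      _ = κ₁ := mul_div_cancel₀ κ₁ hMpos.ne'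
  have hexp : Real.exp (-(κ₁ / U ^ 2)) < t := by
    calc Real.exp (-(κ₁ / U ^ 2)) < Real.exp (Real.log t) := by
          apply Real.exp_lt_exp.2
          have : -Real.log t ≤ M := le_max_right _ _
          linarith
      _ = t := Real.exp_log htpos
  have hΔt : Δ U < t := lt_of_le_of_lt (hpin U hU) hexp
  have hs : s₀ = t * L₁ := by rw [ht, div_mul_cancel₀ s₀ hL₁pos.ne']
  -- the side is positive: `Δ U * L ≥ s₀ > 0` with `L ≥ 0`
  have hLnn : (0 : ℝ) ≤ (L : ℝ) := Nat.cast_nonneg L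
  have hLpos : (0 : ℝ) < (L : ℝ) := by
    rcases hLnn.eq_or_lt with h0 | h0
    · rw [← h0, mul_zero] at hL; linarith
    · exact h0
  -- `L ≤ L₁` would give `Δ U * L < t * L ≤ t * L₁ = s₀`, contradiction
  refine lt_of_le_of_lt (le_max_left L₀ 1) ?_
  by_contra hLL
  push Not at hLL
  have h1 : Δ U * L < t * L := mul_lt_mul_of_pos_right hΔt hLpos
  have h2 : t * L ≤ t * L₁ := mul_le_mul_of_nonneg_left hLL htpos.le
  linarith

/-! ### Necessity: the crux forces a window condensate at scale `Δ(U)² L²` -/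

/-- **Necessity of a window condensate (Yang side of `CoherenceWindowLRO`).** The crux
`CoherenceWindowLRO` implies — with the same doping window `[a,b]`, the same pins and the same
window bottom `s₀`, and `c := c₀/4` — that for every window top `s ≥ s₀` there is `U₁(s) > 0`
such that for `δ ∈ [a,b]`, `U ∈ (0,U₁)`, every even `L` with `s₀ ≤ Δ(U)·L ≤ s` and every
normalised `(2⌊(1-δ)L²/2⌋, S^z = 0)`-sector ground state `ψ` of `hubbardTorus 2 L 1 U`, Yang's
largest `ρ₂`-Rayleigh quotient satisfies `(c₀/4) · Δ(U)² · L² ≤ λ_max(ρ₂(ψ))`. Proof: the crux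
gives `c₀ Δ² L⁴ ≤ Re⟨ψ, Δ_d† Δ_d ψ⟩`, Yang's ceiling gives `Re⟨ψ, Δ_d† Δ_d ψ⟩ ≤ 4L² λ_max`
(for `L ≥ 3`, which holds in the window once `U` is small, `window_side_eventually_large`).
This is the statement of the line's `stub_windowCondensate` with `Δ(U)` weakened to `Δ(U)²`.
Yang, Rev. Mod. Phys. 34 (1962) 694, §4; Scalapino, Phys. Rep. 250 (1995) 329, §2. [folklore] -/
theorem windowCondensate_of_coherenceWindowLRO :
    CoherenceWindowLRO → ∃ (a b κ₁ κ₂ c s₀ : ℝ) (Δ : ℝ → ℝ), 0 < a ∧ a < b ∧ b < 1 / 2 ∧ 0 < κ₁ ∧ κ₁ ≤ κ₂ ∧ 0 < c ∧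
      0 < s₀ ∧ (∀ U : ℝ, 0 < U → Real.exp (-(κ₂ / U ^ 2)) ≤ Δ U ∧ Δ U ≤ Real.exp (-(κ₁ / U ^ 2))) ∧
      ∀ s : ℝ, s₀ ≤ s → ∃ U₁ : ℝ, 0 < U₁ ∧ ∀ δ ∈ Set.Icc a b, ∀ U ∈ Set.Ioo (0 : ℝ) U₁,
        ∀ (L : ℕ) [NeZero L], Even L → s₀ ≤ Δ U * L → Δ U * L ≤ s →
          ∀ ψ : Fock (Orb (FermionTorus 2 L)), star ψ ⬝ᵥ ψ = 1 →
            IsGroundStateInSector (hubbardTorus 2 L 1 U) (2 * ⌊(1 - δ) * (L : ℝ) ^ 2 / 2⌋₊) 0 ψ →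
              c * Δ U ^ 2 * (L : ℝ) ^ 2 ≤ (twoParticleRDM ψ).supRayleigh := by
  rintro ⟨a, b, κ₁, κ₂, c₀, s₀, Δ, ha, hab, hb, hκ₁, hκ₁₂, hc₀, hs₀, hpin, hwin⟩
  refine ⟨a, b, κ₁, κ₂, c₀ / 4, s₀, Δ, ha, hab, hb, hκ₁, hκ₁₂, by positivity, hs₀, hpin, ?_⟩
  intro s hs
  obtain ⟨U₁, hU₁, hW⟩ := hwin s hs
  obtain ⟨U₂, hU₂, hside⟩ := window_side_eventually_large hκ₁ hs₀ (fun U hU => (hpin U hU).2) 2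
  refine ⟨min U₁ U₂, lt_min hU₁ hU₂, ?_⟩
  intro δ hδ U hU L _ hE hlo hhi ψ hψ hgs
  have hU₁' : U ∈ Set.Ioo (0 : ℝ) U₁ := ⟨hU.1, lt_of_lt_of_le hU.2 (min_le_left _ _)⟩
  -- in the window `L ≥ 3` once `U < U₂`
  have hL3 : 3 ≤ L := by
    have h2 : (2 : ℝ) < L := hside U hU.1 (lt_of_lt_of_le hU.2 (min_le_right _ _)) L hlo
    have h2' : 2 < L := by exact_mod_cast h2
    omega
  -- the crux's order bound and Yang's ceiling at this ground state
  have hord := hW δ hδ U hU₁' L hE hlo hhi ψ hψ hgs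
  have hY := re_expect_pairField_dWave_le_supRayleigh L hL3 ψ
  have hLpos : (0 : ℝ) < (L : ℝ) := Nat.cast_pos.mpr (Nat.pos_of_ne_zero (NeZero.ne L))
  have hL4 : (0 : ℝ) < (L : ℝ) ^ 4 := by positivity
  rw [le_div_iff₀ hL4] at hord
  have key : c₀ * Δ U ^ 2 * (L : ℝ) ^ 4 ≤ 4 * (L : ℝ) ^ 2 * (twoParticleRDM ψ).supRayleigh :=
    hord.trans hY
  have hmul : c₀ / 4 * Δ U ^ 2 * (L : ℝ) ^ 2 * (4 * (L : ℝ) ^ 2) ≤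
      (twoParticleRDM ψ).supRayleigh * (4 * (L : ℝ) ^ 2) := by
    calc c₀ / 4 * Δ U ^ 2 * (L : ℝ) ^ 2 * (4 * (L : ℝ) ^ 2) = c₀ * Δ U ^ 2 * (L : ℝ) ^ 4 := by ring
      _ ≤ 4 * (L : ℝ) ^ 2 * (twoParticleRDM ψ).supRayleigh := key
      _ = (twoParticleRDM ψ).supRayleigh * (4 * (L : ℝ) ^ 2) := by ring
  exact le_of_mul_le_mul_right hmul (by positivity)

end Summit.HubbardSuperconductivity.HubbardSuperconductivity.Theorems.BcsKacWindow
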